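import Summits.Ventures.PercRepro.S1FourCircuitW
import Summits.Ventures.PercRepro.RankLevelSetPlaneTen

/-!
# PercRepro — LEMMA X: the five-circuit count by the size of the ground set, `20·s₅ ≤ n(n−1)(n−2)(n−3)` under (C3)
(p2, gen 18)

Under (C3) alone (rank-`≤ 4` sets have `≤ 10` points) a finite matroid on `n` points has at most
`n(n−1)(n−2)(n−3)/20` circuits with five elements — tight on `U_{4,10}` (`n = 10`, `s₅ = 252`). This is LEMMA W
(`S1FourCircuitW`) one level up: four distinct points `a, b, c, d` lie in at most `6` five-circuits (the fifth point
lies in `cl {a, b, c, d}`, a set of rank `≤ 4` with `≤ 10` points, outside `{a, b, c, d}`, and determines the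
circuit), and four double counts — over the fourth points, the third points, the second points, the points — give
`#{C ∋ a, b, c} ≤ 3(n − 3)`, `#{C ∋ a, b} ≤ (n − 2)(n − 3)`, `4·#{C ∋ a} ≤ (n − 1)(n − 2)(n − 3)` and
`20·s₅ ≤ n(n − 1)(n − 2)(n − 3)`. In the cells of the `q = 4` window the `s₅` term carried the crude count
`C(d + 4, 5)`; at the large coranks of the rows `7` and `8` the `n`-bound is a factor `2` to `5` smaller
(`43152` against `98280` at `(8, 24)`), and with LEMMAS V and W′ it closes `(8, 24)`, `(8, 23)`, `(8, 22)` and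
`(7, 38)`, `(7, 39)`, `(7, 40)`.

* `fiveCircuits M` — the circuits with five elements;
* `card_filter_fiveCircuits_four_le` — at most `6` five-circuits through four points;
* `card_filter_fiveCircuits_three_le` — `#{C ∋ a, b, c} ≤ 3(n − 3)`;
* `card_filter_fiveCircuits_pair_le` — `#{C ∋ a, b} ≤ (n − 2)(n − 3)`;
* `four_mul_card_filter_fiveCircuits_point_le` — `4·#{C ∋ a} ≤ (n − 1)(n − 2)(n − 3)`;
* **`twenty_mul_ncard_fiveCircuits_le`** — `20·s₅ ≤ n(n − 1)(n − 2)(n − 3)` under (C3); `ncard_fiveCircuits_le_mul_div`;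
* **`core_twenty_mul_ncard_fiveCircuits_le`**, **`core_ncard_fiveCircuits_le_mul_div`** — on the `e`-free core.
Axioms: standard.
-/

open scoped Matroid

namespace PercRepro

namespace S1

open Set

variable {α : Type}

/-- The five-circuits of `M`: the circuits with exactly `5` elements. -/
def fiveCircuits (M : Matroid α) : Set (Set α) := {C : Set α | M.IsCircuit C ∧ C.ncard = 5}

/-- The five-circuits of a finite matroid form a finite set. -/
theorem finite_fiveCircuits (M : Matroid α) [M.Finite] : (fiveCircuits M).Finite :=
  M.ground_finite.finite_subsets.subset (fun _ hC => hC.1.subset_ground)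

open Classical in
/-- **At most six five-circuits through four given points** (under (C3)): the fifth point lies in the rank-`≤ 4`
set `cl {a, b, c, d}`, which has `≤ 10` points, outside `{a, b, c, d}`, and determines the circuit. -/
theorem card_filter_fiveCircuits_four_le (M : Matroid α) [M.Finite]
    (hC3 : ∀ X ⊆ M.E, M.eRk X ≤ 4 → X.ncard ≤ 10) {a b c d : α} (haE : a ∈ M.E) (hbE : b ∈ M.E)
    (hcE : c ∈ M.E) (hdE : d ∈ M.E) (hab : a ≠ b) (hac : a ≠ c) (had : a ≠ d) (hbc : b ≠ c) (hbd : b ≠ d)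
    (hcd : c ≠ d) :
    ((finite_fiveCircuits M).toFinset.filter
      (fun C => ((a ∈ C ∧ b ∈ C) ∧ c ∈ C) ∧ d ∈ C)).card ≤ 6 := by
  classical
  set X : Set α := {a, b, c, d} with hX
  have hXE : X ⊆ M.E := by
    intro z hz
    rcases hz with rfl | rfl | rfl | rfl
    exacts [haE, hbE, hcE, hdE]
  have haX : a ∉ ({b, c, d} : Set α) := by simp [hab, hac, had]
  have hbX : b ∉ ({c, d} : Set α) := by simp [hbc, hbd]
  have hXcard : X.ncard = 4 := by
    rw [hX, Set.ncard_insert_of_notMem haX, Set.ncard_insert_of_notMem hbX, Set.ncard_pair hcd]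
  have hXfin : X.Finite := M.ground_finite.subset hXE
  have hclE : M.closure X ⊆ M.E := M.closure_subset_ground X
  have hclfin : (M.closure X).Finite := M.ground_finite.subset hclE
  have hclr : M.eRk (M.closure X) ≤ 4 := by
    rw [M.eRk_closure_eq]
    calc M.eRk X ≤ X.encard := M.eRk_le_encard X
      _ = ((X.ncard : ℕ) : ℕ∞) := by rw [hXfin.cast_ncard_eq]
      _ = 4 := by rw [hXcard]; rfl
  have hcl10 : (M.closure X).ncard ≤ 10 := hC3 _ hclE hclr
  have hXcl : X ⊆ M.closure X := M.subset_closure X hXE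
  have hT : (M.closure X \ X).ncard ≤ 6 := by
    rw [Set.ncard_sdiff' hXcl hclfin, hXcard]
    omega
  have hTfin : (M.closure X \ X).Finite := hclfin.subset Set.sdiff_subset
  have hTcard : hTfin.toFinset.card = (M.closure X \ X).ncard := (Set.ncard_eq_toFinset_card _ _).symm
  refine (Finset.card_le_card_of_surjOn (fun e => insert e X) ?_).trans (by rw [hTcard]; exact hT)
  intro C hC
  rw [Finset.mem_coe, Finset.mem_filter, Set.Finite.mem_toFinset] at hC
  obtain ⟨⟨hCc, hC5⟩, ⟨⟨haC, hbC⟩, hcC⟩, hdC⟩ := hC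
  have hXC : X ⊆ C := by
    intro z hz
    rcases hz with rfl | rfl | rfl | rfl
    exacts [haC, hbC, hcC, hdC]
  have hCfin : C.Finite := M.ground_finite.subset hCc.subset_ground
  obtain ⟨e, heC, heX⟩ : ∃ e, e ∈ C ∧ e ∉ X :=
    Set.exists_mem_notMem_of_ncard_lt_ncard (by rw [hXcard, hC5]; norm_num) hXfin
  have hCeq : insert e X = C := by
    refine Set.eq_of_subset_of_ncard_le (Set.insert_subset heC hXC) ?_ hCfin
    rw [hC5, Set.ncard_insert_of_notMem heX hXfin, hXcard]
  refine ⟨e, ?_, hCeq⟩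
  rw [Finset.mem_coe, Set.Finite.mem_toFinset]
  refine ⟨?_, heX⟩
  have h := hCc.mem_closure_sdiff_singleton_of_mem heC
  refine M.closure_subset_closure ?_ h
  intro z hz
  rw [← hCeq] at hz
  obtain ⟨hz1, hz2⟩ := hz
  rcases hz1 with rfl | hz1
  · exact (hz2 (Set.mem_singleton _)).elim
  · exact hz1

open Classical in
/-- **`#{C ∋ a, b, c} ≤ 3(n − 3)`** for distinct points `a, b, c` (under (C3)): the five-circuits through `a, b, c`,
counted with their fourth points. -/
theorem card_filter_fiveCircuits_three_le (M : Matroid α) [M.Finite]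
    (hC3 : ∀ X ⊆ M.E, M.eRk X ≤ 4 → X.ncard ≤ 10) {a b c : α} (haE : a ∈ M.E) (hbE : b ∈ M.E)
    (hcE : c ∈ M.E) (hab : a ≠ b) (hac : a ≠ c) (hbc : b ≠ c) :
    ((finite_fiveCircuits M).toFinset.filter (fun C => (a ∈ C ∧ b ∈ C) ∧ c ∈ C)).card ≤
      3 * (M.E.ncard - 3) := by
  classical
  have hmemE : ∀ x, x ∈ M.ground_finite.toFinset ↔ x ∈ M.E := fun x => Set.Finite.mem_toFinset _
  have hEcard : M.ground_finite.toFinset.card = M.E.ncard := (Set.ncard_eq_toFinset_card _ _).symm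
  set G := (finite_fiveCircuits M).toFinset.filter (fun C => (a ∈ C ∧ b ∈ C) ∧ c ∈ C) with hG
  have hGmem : ∀ C ∈ G, C ⊆ M.E ∧ C.ncard = 5 := by
    intro C hC
    rw [hG, Finset.mem_filter, Set.Finite.mem_toFinset] at hC
    exact ⟨hC.1.1.subset_ground, hC.1.2⟩
  have hsum := sum_card_filter_mem M G 5 hGmem
  have haEf : a ∈ M.ground_finite.toFinset := (hmemE a).2 haE
  have hbEf : b ∈ M.ground_finite.toFinset.erase a := Finset.mem_erase.2 ⟨hab.symm, (hmemE b).2 hbE⟩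
  have hcEf : c ∈ (M.ground_finite.toFinset.erase a).erase b :=
    Finset.mem_erase.2 ⟨hbc.symm, Finset.mem_erase.2 ⟨hac.symm, (hmemE c).2 hcE⟩⟩
  have h1 : ∑ x ∈ M.ground_finite.toFinset, (G.filter (fun C => x ∈ C)).card =
      (G.filter (fun C => a ∈ C)).card +
        ∑ x ∈ M.ground_finite.toFinset.erase a, (G.filter (fun C => x ∈ C)).card :=
    (Finset.add_sum_erase _ (fun x => (G.filter (fun C => x ∈ C)).card) haEf).symm
  have h2 : ∑ x ∈ M.ground_finite.toFinset.erase a, (G.filter (fun C => x ∈ C)).card =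
      (G.filter (fun C => b ∈ C)).card +
        ∑ x ∈ (M.ground_finite.toFinset.erase a).erase b, (G.filter (fun C => x ∈ C)).card :=
    (Finset.add_sum_erase _ (fun x => (G.filter (fun C => x ∈ C)).card) hbEf).symm
  have h3 : ∑ x ∈ (M.ground_finite.toFinset.erase a).erase b, (G.filter (fun C => x ∈ C)).card =
      (G.filter (fun C => c ∈ C)).card +
        ∑ x ∈ ((M.ground_finite.toFinset.erase a).erase b).erase c, (G.filter (fun C => x ∈ C)).card :=
    (Finset.add_sum_erase _ (fun x => (G.filter (fun C => x ∈ C)).card) hcEf).symm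
  have hGa : (G.filter (fun C => a ∈ C)).card = G.card := by
    rw [Finset.filter_true_of_mem]
    intro C hC
    rw [hG, Finset.mem_filter] at hC
    exact hC.2.1.1
  have hGb : (G.filter (fun C => b ∈ C)).card = G.card := by
    rw [Finset.filter_true_of_mem]
    intro C hC
    rw [hG, Finset.mem_filter] at hC
    exact hC.2.1.2
  have hGc : (G.filter (fun C => c ∈ C)).card = G.card := by
    rw [Finset.filter_true_of_mem]
    intro C hC
    rw [hG, Finset.mem_filter] at hC
    exact hC.2.2
  rw [h1, h2, h3, hGa, hGb, hGc] at hsum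
  have hrest : ∑ d ∈ ((M.ground_finite.toFinset.erase a).erase b).erase c,
      (G.filter (fun C => d ∈ C)).card ≤
      ∑ _d ∈ ((M.ground_finite.toFinset.erase a).erase b).erase c, 6 := by
    apply Finset.sum_le_sum
    intro d hd
    rw [Finset.mem_erase, Finset.mem_erase, Finset.mem_erase] at hd
    obtain ⟨hdc, hdb, hda, hdE⟩ := hd
    rw [hG, Finset.filter_filter]
    exact card_filter_fiveCircuits_four_le M hC3 haE hbE hcE ((hmemE d).1 hdE) hab hac (Ne.symm hda) hbc
      (Ne.symm hdb) (Ne.symm hdc)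
  rw [Finset.sum_const, smul_eq_mul, Finset.card_erase_of_mem hcEf, Finset.card_erase_of_mem hbEf,
    Finset.card_erase_of_mem haEf, hEcard] at hrest
  omega

open Classical in
/-- **`#{C ∋ a, b} ≤ (n − 2)(n − 3)`** for distinct points `a, b` (under (C3)): the five-circuits through `a, b`,
counted with their third points. -/
theorem card_filter_fiveCircuits_pair_le (M : Matroid α) [M.Finite]
    (hC3 : ∀ X ⊆ M.E, M.eRk X ≤ 4 → X.ncard ≤ 10) {a b : α} (haE : a ∈ M.E) (hbE : b ∈ M.E) (hab : a ≠ b) :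
    ((finite_fiveCircuits M).toFinset.filter (fun C => a ∈ C ∧ b ∈ C)).card ≤
      (M.E.ncard - 2) * (M.E.ncard - 3) := by
  classical
  have hmemE : ∀ x, x ∈ M.ground_finite.toFinset ↔ x ∈ M.E := fun x => Set.Finite.mem_toFinset _
  have hEcard : M.ground_finite.toFinset.card = M.E.ncard := (Set.ncard_eq_toFinset_card _ _).symm
  set G := (finite_fiveCircuits M).toFinset.filter (fun C => a ∈ C ∧ b ∈ C) with hG
  have hGmem : ∀ C ∈ G, C ⊆ M.E ∧ C.ncard = 5 := by
    intro C hC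
    rw [hG, Finset.mem_filter, Set.Finite.mem_toFinset] at hC
    exact ⟨hC.1.1.subset_ground, hC.1.2⟩
  have hsum := sum_card_filter_mem M G 5 hGmem
  have haEf : a ∈ M.ground_finite.toFinset := (hmemE a).2 haE
  have hbEf : b ∈ M.ground_finite.toFinset.erase a := Finset.mem_erase.2 ⟨hab.symm, (hmemE b).2 hbE⟩
  have h1 : ∑ x ∈ M.ground_finite.toFinset, (G.filter (fun C => x ∈ C)).card =
      (G.filter (fun C => a ∈ C)).card +
        ∑ x ∈ M.ground_finite.toFinset.erase a, (G.filter (fun C => x ∈ C)).card :=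
    (Finset.add_sum_erase _ (fun x => (G.filter (fun C => x ∈ C)).card) haEf).symm
  have h2 : ∑ x ∈ M.ground_finite.toFinset.erase a, (G.filter (fun C => x ∈ C)).card =
      (G.filter (fun C => b ∈ C)).card +
        ∑ x ∈ (M.ground_finite.toFinset.erase a).erase b, (G.filter (fun C => x ∈ C)).card :=
    (Finset.add_sum_erase _ (fun x => (G.filter (fun C => x ∈ C)).card) hbEf).symm
  have hGa : (G.filter (fun C => a ∈ C)).card = G.card := by
    rw [Finset.filter_true_of_mem]
    intro C hC
    rw [hG, Finset.mem_filter] at hC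
    exact hC.2.1
  have hGb : (G.filter (fun C => b ∈ C)).card = G.card := by
    rw [Finset.filter_true_of_mem]
    intro C hC
    rw [hG, Finset.mem_filter] at hC
    exact hC.2.2
  rw [h1, h2, hGa, hGb] at hsum
  have hrest : ∑ c ∈ (M.ground_finite.toFinset.erase a).erase b, (G.filter (fun C => c ∈ C)).card ≤
      ∑ _c ∈ (M.ground_finite.toFinset.erase a).erase b, 3 * (M.E.ncard - 3) := by
    apply Finset.sum_le_sum
    intro c hc
    rw [Finset.mem_erase, Finset.mem_erase] at hc
    obtain ⟨hcb, hca, hcE⟩ := hc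
    rw [hG, Finset.filter_filter]
    exact card_filter_fiveCircuits_three_le M hC3 haE hbE ((hmemE c).1 hcE) hab (Ne.symm hca) (Ne.symm hcb)
  rw [Finset.sum_const, smul_eq_mul, Finset.card_erase_of_mem hbEf, Finset.card_erase_of_mem haEf,
    hEcard] at hrest
  -- hsum : G.card + (G.card + Σ rest) = 5 * G.card ; hrest : Σ rest ≤ (n - 1 - 1) * (3 * (n - 3))
  have h3 : 3 * G.card ≤ 3 * ((M.E.ncard - 2) * (M.E.ncard - 3)) := by
    calc 3 * G.card = ∑ c ∈ (M.ground_finite.toFinset.erase a).erase b, (G.filter (fun C => c ∈ C)).card := by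
          omega
      _ ≤ (M.E.ncard - 1 - 1) * (3 * (M.E.ncard - 3)) := hrest
      _ = 3 * ((M.E.ncard - 2) * (M.E.ncard - 3)) := by
          have : M.E.ncard - 1 - 1 = M.E.ncard - 2 := by omega
          rw [this]; ring
  exact Nat.le_of_mul_le_mul_left h3 (by norm_num)

open Classical in
/-- **`4·#{C ∋ a} ≤ (n − 1)(n − 2)(n − 3)`** for a point `a` (under (C3)): the five-circuits through `a`, counted
with their second points. -/
theorem four_mul_card_filter_fiveCircuits_point_le (M : Matroid α) [M.Finite]
    (hC3 : ∀ X ⊆ M.E, M.eRk X ≤ 4 → X.ncard ≤ 10) {a : α} (haE : a ∈ M.E) :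
    4 * ((finite_fiveCircuits M).toFinset.filter (fun C => a ∈ C)).card ≤
      (M.E.ncard - 1) * ((M.E.ncard - 2) * (M.E.ncard - 3)) := by
  classical
  have hmemE : ∀ x, x ∈ M.ground_finite.toFinset ↔ x ∈ M.E := fun x => Set.Finite.mem_toFinset _
  have hEcard : M.ground_finite.toFinset.card = M.E.ncard := (Set.ncard_eq_toFinset_card _ _).symm
  set H := (finite_fiveCircuits M).toFinset.filter (fun C => a ∈ C) with hH
  have hHmem : ∀ C ∈ H, C ⊆ M.E ∧ C.ncard = 5 := by
    intro C hC
    rw [hH, Finset.mem_filter, Set.Finite.mem_toFinset] at hC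
    exact ⟨hC.1.1.subset_ground, hC.1.2⟩
  have hsum := sum_card_filter_mem M H 5 hHmem
  have haEf : a ∈ M.ground_finite.toFinset := (hmemE a).2 haE
  have h1 : ∑ x ∈ M.ground_finite.toFinset, (H.filter (fun C => x ∈ C)).card =
      (H.filter (fun C => a ∈ C)).card +
        ∑ x ∈ M.ground_finite.toFinset.erase a, (H.filter (fun C => x ∈ C)).card :=
    (Finset.add_sum_erase _ (fun x => (H.filter (fun C => x ∈ C)).card) haEf).symm
  have hHa : (H.filter (fun C => a ∈ C)).card = H.card := by
    rw [Finset.filter_true_of_mem]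
    intro C hC
    rw [hH, Finset.mem_filter] at hC
    exact hC.2
  rw [h1, hHa] at hsum
  have hrest : ∑ b ∈ M.ground_finite.toFinset.erase a, (H.filter (fun C => b ∈ C)).card ≤
      ∑ _b ∈ M.ground_finite.toFinset.erase a, (M.E.ncard - 2) * (M.E.ncard - 3) := by
    apply Finset.sum_le_sum
    intro b hb
    rw [Finset.mem_erase] at hb
    obtain ⟨hba, hbE⟩ := hb
    rw [hH, Finset.filter_filter]
    exact card_filter_fiveCircuits_pair_le M hC3 haE ((hmemE b).1 hbE) (Ne.symm hba)
  rw [Finset.sum_const, smul_eq_mul, Finset.card_erase_of_mem haEf, hEcard] at hrest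
  omega

/-- **LEMMA X**: under (C3), `20·s₅ ≤ n(n − 1)(n − 2)(n − 3)` — the five-circuits by the size of the ground set. -/
theorem twenty_mul_ncard_fiveCircuits_le (M : Matroid α) [M.Finite]
    (hC3 : ∀ X ⊆ M.E, M.eRk X ≤ 4 → X.ncard ≤ 10) :
    20 * (fiveCircuits M).ncard ≤ M.E.ncard * (M.E.ncard - 1) * (M.E.ncard - 2) * (M.E.ncard - 3) := by
  classical
  have hmemE : ∀ x, x ∈ M.ground_finite.toFinset ↔ x ∈ M.E := fun x => Set.Finite.mem_toFinset _
  have hEcard : M.ground_finite.toFinset.card = M.E.ncard := (Set.ncard_eq_toFinset_card _ _).symm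
  have hF5 : (fiveCircuits M).ncard = (finite_fiveCircuits M).toFinset.card :=
    Set.ncard_eq_toFinset_card _ _
  have hsum := sum_card_filter_mem M (finite_fiveCircuits M).toFinset 5 (fun C hC => by
    rw [Set.Finite.mem_toFinset] at hC
    exact ⟨hC.1.subset_ground, hC.2⟩)
  have hle : ∑ a ∈ M.ground_finite.toFinset,
      4 * ((finite_fiveCircuits M).toFinset.filter (fun C => a ∈ C)).card ≤
      ∑ _a ∈ M.ground_finite.toFinset, (M.E.ncard - 1) * ((M.E.ncard - 2) * (M.E.ncard - 3)) :=
    Finset.sum_le_sum (fun a ha => four_mul_card_filter_fiveCircuits_point_le M hC3 ((hmemE a).1 ha))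
  rw [← Finset.mul_sum, hsum, Finset.sum_const, smul_eq_mul, hEcard] at hle
  rw [hF5]
  calc 20 * (finite_fiveCircuits M).toFinset.card = 4 * (5 * (finite_fiveCircuits M).toFinset.card) := by ring
    _ ≤ M.E.ncard * ((M.E.ncard - 1) * ((M.E.ncard - 2) * (M.E.ncard - 3))) := hle
    _ = M.E.ncard * (M.E.ncard - 1) * (M.E.ncard - 2) * (M.E.ncard - 3) := by ring

/-- **LEMMA X, the cap**: `s₅ ≤ ⌊n(n − 1)(n − 2)(n − 3)/20⌋` under (C3). -/
theorem ncard_fiveCircuits_le_mul_div (M : Matroid α) [M.Finite]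
    (hC3 : ∀ X ⊆ M.E, M.eRk X ≤ 4 → X.ncard ≤ 10) :
    (fiveCircuits M).ncard ≤ M.E.ncard * (M.E.ncard - 1) * (M.E.ncard - 2) * (M.E.ncard - 3) / 20 := by
  rw [Nat.le_div_iff_mul_le (by norm_num), mul_comm]
  exact twenty_mul_ncard_fiveCircuits_le M hC3

/-- **LEMMA X on the `e`-free core**, in the set-builder vocabulary of `S1RowTwelve`:
`20·s₅ ≤ n(n − 1)(n − 2)(n − 3)`. -/
theorem core_twenty_mul_ncard_fiveCircuits_le (M : Matroid α) [M.Finite]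
    (hfree : ∀ e ∈ M.E, ∃ A ⊆ M.E \ {e}, e ∉ M.closure A ∧ e ∉ M.closure ((M.E \ {e}) \ A)) :
    20 * {C : Set α | M.IsCircuit C ∧ C.ncard = 5}.ncard ≤
      M.E.ncard * (M.E.ncard - 1) * (M.E.ncard - 2) * (M.E.ncard - 3) := by
  have hten : ∀ X ⊆ M.E, M.eRk X ≤ 4 → X.ncard ≤ 10 := fun X hX hr =>
    ThmN.ncard_le_ten_of_eRk_le_four_of_free M hfree hX hr
  exact twenty_mul_ncard_fiveCircuits_le M hten

/-- **LEMMA X on the `e`-free core, the cap**: `s₅ ≤ ⌊n(n − 1)(n − 2)(n − 3)/20⌋`. -/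
theorem core_ncard_fiveCircuits_le_mul_div (M : Matroid α) [M.Finite]
    (hfree : ∀ e ∈ M.E, ∃ A ⊆ M.E \ {e}, e ∉ M.closure A ∧ e ∉ M.closure ((M.E \ {e}) \ A)) :
    {C : Set α | M.IsCircuit C ∧ C.ncard = 5}.ncard ≤
      M.E.ncard * (M.E.ncard - 1) * (M.E.ncard - 2) * (M.E.ncard - 3) / 20 := by
  rw [Nat.le_div_iff_mul_le (by norm_num), mul_comm]
  exact core_twenty_mul_ncard_fiveCircuits_le M hfree

end S1

end PercRepro
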